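import Literature.AlgebraicGeometry.DeterminantalHypersurfaces.ChanIltenFanoNonempty
import Literature.Combinatorics.Optimization.KonigLineCover

/-!
# Chan–Ilten 2015, Proposition 2.6 — the "only if" halves; `ChanIlten.proposition26` DISCHARGED

Topic `Literature/AlgebraicGeometry/DeterminantalHypersurfaces`, sibling of `ChanIltenFanoNonempty.lean` (the typed
fact `ChanIlten.proposition26` — M. Chan, N. Ilten, *Fano schemes of determinants and permanents*, Algebra &
Number Theory 9 (2015) 629–679, arXiv:1312.2577, **Proposition 2.6** (held text `paper:arxiv-1312.2577`,
p0007 L28–29): "The Fano schemes `F_k(D^r_{m,n})` and `F_k(P^r_{m,n})` are nonempty if and only if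
`k < (r-1)n`." — together with its "if" halves `ChanIlten.proposition26_if`).  This file proves the "only if"
halves and hence the fact itself: `ChanIlten.proposition26_holds : ChanIlten.proposition26` (no `sorry`, no new
definition, no new named fact).

## The printed proof and how it is formalised
§2.2 (p0006 L44–48): the row/column torus `T_m × T_n` acts on the Grassmannian `G(k+1, mn)` and on both Fano
schemes; "any linear relation on the entries that has more than one term cannot be preserved under all possible
rescaling of rows and columns. So [a torus fixed point] `Q` must consist of all matrices obtained by setting all
but `k+1` specified entries to zero."  Proposition 2.3 (proof, p0007 L2–8): such a coordinate subspace lies in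
`F_k(D)` (resp. `F_k(P)`) iff its bipartite graph of starred entries has no matching of any `r` rows — "if `G`
has such a matching, then specializing the `r` entries corresponding to the edges in that matching to `1`, and
setting all others to zero, gives a nonzero `r × r` determinant (or permanent)" — and then (Lemma 2.4, Hall) it
sits in a standard `s`-compression space.  Remark 2.5 (p0007 L24): "our Fano schemes are projective … and thus
must contain a torus fixed point" (Borel).  Proposition 2.6 (proof, p0007 L31–35): hence nonempty iff
`k ≤ κ(s)` for some `s`, and `κ(r-1) = (r-1)n - 1` is the maximum.

Here, in the K-point form of the typed fact (a `(k+1)`-dimensional `W ≤ Mat_{m×n}(K)` on which all `r × r`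
minors, resp. sub-permanents, vanish), with determinant and permanent treated at once as `ε`-weighted
permutation sums `Σ_σ ε(σ) Π_i A (σ i) i` (`ε = sign`: `Matrix.det_apply'`; `ε = 1`: `Matrix.permanent`):
* `wsum_row_col_scale`, `wsum_one` — torus semi-invariance of the sums, and their value `ε 1` at the identity;
* `finrank_le_card_of_support`, `exists_lead` — the LEADING POSITIONS of `W` for the lex weight
  `wt(i,j) = n·i + j` (a one-parameter subgroup of the torus) number at least `finrank W`;
* `wsum_vanish_of_leads` — **the Borel / degeneration step made explicit**: if the sums vanish on `W` they vanish
  on the coordinate subspace spanned by the leading positions (`u_t = Σ c_l t^{B-wt(p_l)} w_l ∈ W`, torus-scaled,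
  is `t^B N(t)` for a polynomial matrix `N` with `N(0)` the coordinate matrix; the scaled sum is a monomial in `t`
  times the sum at `u_t`, so it vanishes for `t ≠ 0`, hence identically since `K = K̄` is infinite
  (`IsAlgClosed.instInfinite`, `Polynomial.funext`), hence at `t = 0`);
* `indicator_submatrix_eq_one` — the "specialize the matched entries to `1`" matrix of Proposition 2.3;
* `card_le_of_no_matching` — a position set with no `r` cells in distinct rows and columns has `≤ (r-1)·n` cells
  (`m ≤ n`), read off the TREE's Kőnig theorem
  `Literature.Combinatorics.Optimization.KonigLineCover.exists_isScattered_isLineCover_card_eq` (cited, not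
  restated) — this replaces the `κ`-convexity bookkeeping of the printed proof by the bound it yields;
* `lt_of_wsum_vanish` (both halves at once) and `proposition26_holds`.
The hypothesis `char K ≠ 2` carried by the permanental half of the typed fact is not used in this direction; the
determinantal half is classically Dieudonné's theorem [CI15 ref. dieudonne] / Flanders' bound, re-proved here by
the same degeneration.

Honest framing: a Literature discharge (census −1) adjacent to geometric complexity theory; it is used by the
`ValiantsHypothesis` line `laplace_rigidity` only as the known case `k = 1` ("`PR₁(per_n) = n`"); nothing here
bears on `VP ≠ VNP` (NOT proved). [cite: ChanIlten2015, Proposition 2.6]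
-/

namespace Literature.AlgebraicGeometry.DeterminantalHypersurfaces.ChanIlten

open Matrix Finset

section WeightedPermutationSums

variable {r : ℕ}

/-- Row/column scaling of an `ε`-weighted permutation sum `Σ_σ ε(σ) Π_i A (σ i) i` (`ε = sign`: determinant,
`Matrix.det_apply'`; `ε = 1`: permanent, `Matrix.permanent`): semi-invariance under the row/column torus
`T_m × T_n` "that act by rescaling the rows (respectively the columns)". [cite: ChanIlten2015, §2.2 (p. 6)] -/
theorem wsum_row_col_scale {R : Type*} [CommRing R] (ε : Equiv.Perm (Fin r) → ℤ)
    (u v : Fin r → R) (A : Matrix (Fin r) (Fin r) R) :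
    (∑ σ : Equiv.Perm (Fin r), (ε σ : R) * ∏ i, (u (σ i) * v i * A (σ i) i)) =
      ((∏ i, u i) * ∏ i, v i) * ∑ σ : Equiv.Perm (Fin r), (ε σ : R) * ∏ i, A (σ i) i := by
  have h : ∀ σ : Equiv.Perm (Fin r),
      (∏ i, (u (σ i) * v i * A (σ i) i)) = ((∏ i, u i) * ∏ i, v i) * ∏ i, A (σ i) i := by
    intro σ
    rw [Finset.prod_mul_distrib, Finset.prod_mul_distrib, Equiv.prod_comp σ u]
  simp_rw [h]
  rw [Finset.mul_sum]
  refine Finset.sum_congr rfl fun σ _ => ?_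
  ring

/-- The `ε`-weighted permutation sum of the identity matrix is `ε 1` ("gives a nonzero `r × r` determinant (or
permanent)"). [cite: ChanIlten2015, Proposition 2.3 (proof)] -/
theorem wsum_one {R : Type*} [CommRing R] (ε : Equiv.Perm (Fin r) → ℤ) :
    (∑ σ : Equiv.Perm (Fin r), (ε σ : R) * ∏ i, (1 : Matrix (Fin r) (Fin r) R) (σ i) i) = (ε 1 : R) := by
  have hterm : ∀ σ : Equiv.Perm (Fin r), σ ≠ 1 →
      (ε σ : R) * ∏ i, (1 : Matrix (Fin r) (Fin r) R) (σ i) i = 0 := by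
    intro σ hσ
    obtain ⟨x, hx⟩ : ∃ x, σ x ≠ x := by
      by_contra h
      exact hσ (Equiv.ext fun x => by
        rw [Equiv.Perm.one_apply]; exact not_not.mp (not_exists.mp h x))
    rw [Finset.prod_eq_zero (f := fun i => (1 : Matrix (Fin r) (Fin r) R) (σ i) i) (Finset.mem_univ x)
      (Matrix.one_apply_ne hx), mul_zero]
  have hone : ∏ i, (1 : Matrix (Fin r) (Fin r) R) ((1 : Equiv.Perm (Fin r)) i) i = 1 :=
    Finset.prod_eq_one fun i _ => by rw [Equiv.Perm.one_apply]; exact Matrix.one_apply_eq i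
  rw [Fintype.sum_eq_single 1 hterm, hone, mul_one]

end WeightedPermutationSums

section Koenig

/-- **König's count** (the `κ(r-1) + 1 = (r-1)n` of the printed proof): a set of positions of an `m × n` board,
`m ≤ n`, meeting no `r` cells in pairwise distinct rows and columns has at most `(r-1)·n` cells — by the tree's
Kőnig minimax theorem `Literature.Combinatorics.Optimization.KonigLineCover.exists_isScattered_isLineCover_card_eq`
(a largest scattered subset has as many cells as a smallest line cover has lines) such a set is covered by
`≤ r - 1` lines of `≤ n` cells each (the paper argues with Hall's theorem, Lemma 2.4).
[cite: ChanIlten2015, Proposition 2.3 and Lemma 2.4 (proof of Proposition 2.6)] -/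
theorem card_le_of_no_matching {m n r : ℕ} (hmn : m ≤ n) (S : Finset (Fin m × Fin n))
    (hS : ¬ ∃ (ρ : Fin r ↪ Fin m) (γ : Fin r ↪ Fin n), ∀ x, (ρ x, γ x) ∈ S) :
    S.card ≤ (r - 1) * n := by
  classical
  obtain ⟨T, hTS, R, C, hT, hRC, hcard⟩ :=
    Literature.Combinatorics.Optimization.KonigLineCover.exists_isScattered_isLineCover_card_eq S
  -- a scattered subset of `S` has fewer than `r` cells
  have hTr : T.card ≤ r - 1 := by
    by_contra hlt
    have hrT : r ≤ T.card := by omega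
    let e : Fin r ↪ T :=
      (Fin.castLEEmb hrT).trans (Fintype.equivFinOfCardEq (Fintype.card_coe T)).symm.toEmbedding
    exact hS
      ⟨⟨fun x => (e x).1.1, fun x y hxy => e.injective (Subtype.ext (hT.1 _ (e x).2 _ (e y).2 hxy))⟩,
        ⟨fun x => (e x).1.2, fun x y hxy => e.injective (Subtype.ext (hT.2 _ (e x).2 _ (e y).2 hxy))⟩,
        fun x => hTS (e x).2⟩
  -- a line cover by `#R + #C = #T ≤ r - 1` lines, each of `≤ n` cells
  calc S.card ≤ (R ×ˢ (Finset.univ : Finset (Fin n)) ∪ (Finset.univ : Finset (Fin m)) ×ˢ C).card :=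
        Finset.card_le_card fun q hq => by
          rcases hRC q hq with h | h
          · exact Finset.mem_union_left _ (Finset.mem_product.2 ⟨h, Finset.mem_univ _⟩)
          · exact Finset.mem_union_right _ (Finset.mem_product.2 ⟨Finset.mem_univ _, h⟩)
    _ ≤ (R ×ˢ (Finset.univ : Finset (Fin n))).card + ((Finset.univ : Finset (Fin m)) ×ˢ C).card :=
        Finset.card_union_le _ _
    _ = R.card * n + m * C.card := by simp [Finset.card_product]
    _ ≤ R.card * n + n * C.card := Nat.add_le_add_left (Nat.mul_le_mul_right C.card hmn) _
    _ = (R.card + C.card) * n := by ring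
    _ ≤ (r - 1) * n := Nat.mul_le_mul_right n (by omega)

end Koenig

section LeadingPositions

/-- If every nonzero element of `W` has a nonzero entry at some position of `L`, then reading off the
`L`-entries is injective on `W`, so `finrank W ≤ |L|`. [cite: ChanIlten2015, §2.2 (torus fixed points)] -/
theorem finrank_le_card_of_support {K : Type*} [Field K] {m n : ℕ}
    (W : Submodule K (Matrix (Fin m) (Fin n) K)) (L : Finset (Fin m × Fin n))
    (hL : ∀ w ∈ W, w ≠ 0 → ∃ q ∈ L, w q.1 q.2 ≠ 0) :
    Module.finrank K W ≤ L.card := by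
  classical
  let T : W →ₗ[K] (L → K) :=
    { toFun := fun w q => (w : Matrix (Fin m) (Fin n) K) q.1.1 q.1.2
      map_add' := fun w w' => by ext q; simp
      map_smul' := fun c w => by ext q; simp }
  have hT : Function.Injective T := by
    rw [injective_iff_map_eq_zero]
    intro w hw
    by_contra hne
    have hne' : (w : Matrix (Fin m) (Fin n) K) ≠ 0 := by
      rwa [Ne, Submodule.coe_eq_zero]
    obtain ⟨q, hqL, hq⟩ := hL w w.2 hne'
    exact hq (by simpa [T] using congr_fun hw ⟨q, hqL⟩)
  calc Module.finrank K W ≤ Module.finrank K (L → K) := LinearMap.finrank_le_finrank_of_injective hT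
    _ = L.card := by rw [Module.finrank_fintype_fun_eq_card, Fintype.card_coe]

/-- Every nonzero matrix has a LEADING position for a weight `wt`: a nonzero entry below which (in weight)
all entries vanish. [cite: ChanIlten2015, §2.2 (torus fixed points)] -/
theorem exists_lead {K : Type*} [Field K] {m n : ℕ} (wt : Fin m × Fin n → ℕ)
    (w : Matrix (Fin m) (Fin n) K) (hw : w ≠ 0) :
    ∃ p : Fin m × Fin n, w p.1 p.2 ≠ 0 ∧ ∀ q : Fin m × Fin n, wt q < wt p → w q.1 q.2 = 0 := by
  classical
  have hne : (Finset.univ.filter fun q : Fin m × Fin n => w q.1 q.2 ≠ 0).Nonempty := by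
    by_contra h
    rw [Finset.not_nonempty_iff_eq_empty, Finset.filter_eq_empty_iff] at h
    exact hw (Matrix.ext fun i j => by simpa using h (Finset.mem_univ (i, j)))
  obtain ⟨p, hp, hmin⟩ := Finset.exists_min_image _ wt hne
  refine ⟨p, (Finset.mem_filter.1 hp).2, fun q hq => ?_⟩
  by_contra hq'
  exact absurd (hmin q (Finset.mem_filter.2 ⟨Finset.mem_univ _, hq'⟩)) (not_le.2 hq)

end LeadingPositions

section Degeneration

/-- **The degeneration step** (Borel fixed point for the torus, made explicit).  Let `a, b` be row/column
weights with `(i, j) ↦ a i + b j` injective, `W` a subspace on which the `ε`-weighted permutation sum of the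
`(ρ, γ)`-entries vanishes, and `w l ∈ W` elements with pairwise distinct leading positions `p l` (entry
`≠ 0` at `p l`, entries `0` at all positions of smaller weight).  Then the same sum vanishes at every matrix
`M` supported on `{p l}`: with `u_t = Σ_l c_l t^{B - wt(p l)} w l ∈ W` one has
`(t^{a i + b j} (u_t)_{ij}) = t^B N(t)` for a polynomial matrix `N(t)` with `N(0) = M`, the scaled sum is
`t^{Σ a∘ρ + Σ b∘γ}` times the sum at `u_t`, hence `0` for all `t ≠ 0`, hence identically (K infinite),
hence at `t = 0`.  This is Remark 2.5 ("our Fano schemes are projective … and thus must contain a torus fixed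
point") for the chosen one-parameter subgroup. [cite: ChanIlten2015, Remark 2.5 and §2.2] -/
theorem wsum_vanish_of_leads {K : Type*} [Field K] [Infinite K] {m n r : ℕ}
    (a : Fin m → ℕ) (b : Fin n → ℕ) (hwt : Function.Injective fun q : Fin m × Fin n => a q.1 + b q.2)
    (W : Submodule K (Matrix (Fin m) (Fin n) K))
    (ε : Equiv.Perm (Fin r) → ℤ) (ρ : Fin r → Fin m) (γ : Fin r → Fin n)
    (hW : ∀ M ∈ W, (∑ σ : Equiv.Perm (Fin r), (ε σ : K) * ∏ i, M (ρ (σ i)) (γ i)) = 0)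
    {ι : Type*} [Fintype ι] (p : ι → Fin m × Fin n) (hp : Function.Injective p)
    (w : ι → Matrix (Fin m) (Fin n) K) (hwW : ∀ l, w l ∈ W) (hlead : ∀ l, w l (p l).1 (p l).2 ≠ 0)
    (hbelow : ∀ l (q : Fin m × Fin n), a q.1 + b q.2 < a (p l).1 + b (p l).2 → w l q.1 q.2 = 0)
    (M : Matrix (Fin m) (Fin n) K) (hM : ∀ q : Fin m × Fin n, q ∉ Set.range p → M q.1 q.2 = 0) :
    (∑ σ : Equiv.Perm (Fin r), (ε σ : K) * ∏ i, M (ρ (σ i)) (γ i)) = 0 := by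
  classical
  -- the polynomial family `N(t)`: `W`-elements at `t ≠ 0` (up to the torus), the coordinate matrix `M` at `0`
  let N : Fin m → Fin n → Polynomial K := fun i j =>
    ∑ l, Polynomial.C (M (p l).1 (p l).2 / w l (p l).1 (p l).2 * w l i j) *
      Polynomial.X ^ (a i + b j - (a (p l).1 + b (p l).2))
  let F : Polynomial K := ∑ σ : Equiv.Perm (Fin r), (ε σ : Polynomial K) * ∏ i, N (ρ (σ i)) (γ i)
  have hevalN : ∀ t i j, (N i j).eval t =
      ∑ l, M (p l).1 (p l).2 / w l (p l).1 (p l).2 * w l i j *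
        t ^ (a i + b j - (a (p l).1 + b (p l).2)) := by
    intro t i j
    simp only [N, Polynomial.eval_finsetSum, Polynomial.eval_mul, Polynomial.eval_C,
      Polynomial.eval_pow, Polynomial.eval_X]
  have hevalF : ∀ t, F.eval t =
      ∑ σ : Equiv.Perm (Fin r), (ε σ : K) * ∏ i, (N (ρ (σ i)) (γ i)).eval t := by
    intro t
    simp only [F, Polynomial.eval_finsetSum, Polynomial.eval_mul, Polynomial.eval_intCast,
      Polynomial.eval_prod]
  -- a summand of `N i j` indexed by `l` with `p l ≠ (i, j)` vanishes at `t = 0`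
  have hterm : ∀ l i j, p l ≠ (i, j) →
      M (p l).1 (p l).2 / w l (p l).1 (p l).2 * w l i j *
        (0 : K) ^ (a i + b j - (a (p l).1 + b (p l).2)) = 0 := by
    intro l i j hne
    by_cases hz : w l i j = 0
    · simp [hz]
    · have hle : a (p l).1 + b (p l).2 ≤ a i + b j := by
        by_contra hlt
        exact hz (hbelow l (i, j) (not_le.1 hlt))
      have hne' : a (p l).1 + b (p l).2 ≠ a i + b j := fun h => hne (hwt h)
      have hpos : a i + b j - (a (p l).1 + b (p l).2) ≠ 0 := by omega
      rw [zero_pow hpos, mul_zero]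
  -- Step 1: `F(t) = 0` for every `t ≠ 0`, by torus equivariance of the weighted permutation sum
  have h1 : ∀ t : K, t ≠ 0 → F.eval t = 0 := by
    intro t ht
    obtain ⟨B, hB⟩ : ∃ B, ∀ l, a (p l).1 + b (p l).2 ≤ B :=
      ⟨Finset.univ.sup fun l => a (p l).1 + b (p l).2, fun l =>
        Finset.le_sup (f := fun l => a (p l).1 + b (p l).2) (Finset.mem_univ l)⟩
    let u : Matrix (Fin m) (Fin n) K :=
      ∑ l, (M (p l).1 (p l).2 / w l (p l).1 (p l).2 * t ^ (B - (a (p l).1 + b (p l).2))) • w l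
    have huW : u ∈ W := W.sum_mem fun l _ => W.smul_mem _ (hwW l)
    have hu0 := hW u huW
    have hentry : ∀ i j, t ^ a i * t ^ b j * u i j = t ^ B * (1 : K) * (N i j).eval t := by
      intro i j
      rw [hevalN, mul_one]
      simp only [u, Matrix.sum_apply, Matrix.smul_apply, smul_eq_mul, Finset.mul_sum]
      refine Finset.sum_congr rfl fun l _ => ?_
      by_cases hz : w l i j = 0
      · simp [hz]
      · have hle : a (p l).1 + b (p l).2 ≤ a i + b j := by
          by_contra hlt
          exact hz (hbelow l (i, j) (not_le.1 hlt))
        have key : t ^ a i * t ^ b j * t ^ (B - (a (p l).1 + b (p l).2)) =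
            t ^ B * t ^ (a i + b j - (a (p l).1 + b (p l).2)) := by
          rw [← pow_add, ← pow_add, ← pow_add]
          congr 1
          have := hB l
          omega
        calc t ^ a i * t ^ b j *
              (M (p l).1 (p l).2 / w l (p l).1 (p l).2 * t ^ (B - (a (p l).1 + b (p l).2)) * w l i j)
            = t ^ a i * t ^ b j * t ^ (B - (a (p l).1 + b (p l).2)) *
                (M (p l).1 (p l).2 / w l (p l).1 (p l).2 * w l i j) := by ring
          _ = t ^ B * t ^ (a i + b j - (a (p l).1 + b (p l).2)) *
                (M (p l).1 (p l).2 / w l (p l).1 (p l).2 * w l i j) := by rw [key]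
          _ = t ^ B * (M (p l).1 (p l).2 / w l (p l).1 (p l).2 * w l i j *
                t ^ (a i + b j - (a (p l).1 + b (p l).2))) := by ring
    have hs1 := wsum_row_col_scale ε (fun x => t ^ a (ρ x)) (fun y => t ^ b (γ y))
      (fun x y => u (ρ x) (γ y))
    have hs2 := wsum_row_col_scale ε (fun _ => t ^ B) (fun _ => (1 : K))
      (fun x y => (N (ρ x) (γ y)).eval t)
    have heq : (∑ σ : Equiv.Perm (Fin r), (ε σ : K) *
          ∏ i, (t ^ a (ρ (σ i)) * t ^ b (γ i) * u (ρ (σ i)) (γ i))) =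
        ∑ σ : Equiv.Perm (Fin r), (ε σ : K) * ∏ i, (t ^ B * (1 : K) * (N (ρ (σ i)) (γ i)).eval t) := by
      refine Finset.sum_congr rfl fun σ _ => ?_
      rw [Finset.prod_congr rfl fun i _ => hentry (ρ (σ i)) (γ i)]
    rw [hs1, hs2, hu0, mul_zero] at heq
    have hpow : (∏ _x : Fin r, t ^ B) * ∏ _x : Fin r, (1 : K) ≠ 0 := by
      simp [Finset.prod_const, ht]
    rw [hevalF]
    exact (mul_eq_zero.1 heq.symm).resolve_left hpow
  -- Step 2: `F = 0`, since `K` is infinite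
  have h2 : F = 0 := by
    have hXF : Polynomial.X * F = 0 := by
      apply Polynomial.funext
      intro t
      rw [Polynomial.eval_mul, Polynomial.eval_X, Polynomial.eval_zero]
      by_cases ht : t = 0
      · rw [ht, zero_mul]
      · rw [h1 t ht, mul_zero]
    exact (mul_eq_zero.1 hXF).resolve_left Polynomial.X_ne_zero
  -- Step 3: at `t = 0` the family is the coordinate matrix `M`
  have hN0 : ∀ i j, (N i j).eval 0 = M i j := by
    intro i j
    rw [hevalN]
    by_cases hij : ∃ l, p l = (i, j)
    · obtain ⟨l₀, hl₀⟩ := hij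
      rw [Fintype.sum_eq_single l₀ (fun l hl => hterm l i j fun h => hl (hp (h.trans hl₀.symm)))]
      have hi : (p l₀).1 = i := by rw [hl₀]
      have hj : (p l₀).2 = j := by rw [hl₀]
      subst hi hj
      rw [Nat.sub_self, pow_zero, mul_one, div_mul_cancel₀ _ (hlead l₀)]
    · rw [Finset.sum_eq_zero fun l _ => hterm l i j fun h => hij ⟨l, h⟩]
      exact (hM (i, j) fun ⟨l, hl⟩ => hij ⟨l, hl⟩).symm
  have h3 : F.eval 0 = 0 := by rw [h2, Polynomial.eval_zero]
  rw [hevalF] at h3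
  simpa only [hN0] using h3

end Degeneration

section Assembly

/-- A position set carrying `r` cells in distinct rows `ρ` and distinct columns `γ` supports the partial
permutation matrix whose `(ρ, γ)`-submatrix is the identity ("specializing the `r` entries corresponding to
the edges in that matching to `1`, and setting all others to zero"). [cite: ChanIlten2015, Proposition 2.3 (proof)] -/
theorem indicator_submatrix_eq_one {K : Type*} [Field K] {m n r : ℕ} (ρ : Fin r ↪ Fin m) (γ : Fin r ↪ Fin n)
    (x y : Fin r) :
    (if ∃ z, ρ z = ρ x ∧ γ z = γ y then (1 : K) else 0) = (1 : Matrix (Fin r) (Fin r) K) x y := by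
  by_cases hxy : x = y
  · subst hxy
    rw [Matrix.one_apply_eq, if_pos ⟨x, rfl, rfl⟩]
  · rw [Matrix.one_apply_ne hxy, if_neg]
    rintro ⟨z, hz, hz'⟩
    exact hxy ((ρ.injective hz).symm.trans (γ.injective hz'))

/-- **Main lemma** (both halves of the "only if" at once).  Over an infinite field, if a `(k+1)`-dimensional
subspace `W` of `m × n` matrices, `m ≤ n`, kills the `ε`-weighted `r × r` permutation sums along all
row/column selections `ρ, γ`, and `ε 1 ≠ 0` in `K`, then `k < (r-1)·n`: the leading positions of `W` number at
least `finrank W = k + 1`, the sums vanish on the coordinate subspace they span (degeneration), so they meet no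
`r` cells in distinct rows and columns, hence number at most `(r-1)·n` (König).
[cite: ChanIlten2015, Proposition 2.6 (proof)] -/
theorem lt_of_wsum_vanish {K : Type*} [Field K] [Infinite K] {m n r k : ℕ}
    (hmn : m ≤ n) (ε : Equiv.Perm (Fin r) → ℤ) (hε : (ε 1 : K) ≠ 0)
    (W : Submodule K (Matrix (Fin m) (Fin n) K)) (hW : Module.finrank K W = k + 1)
    (hvan : ∀ M ∈ W, ∀ (ρ : Fin r ↪ Fin m) (γ : Fin r ↪ Fin n),
      (∑ σ : Equiv.Perm (Fin r), (ε σ : K) * ∏ i, M (ρ (σ i)) (γ i)) = 0) :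
    k < (r - 1) * n := by
  classical
  -- the lex one-parameter subgroup of the row/column torus: weights `wt(i,j) = n·i + j`
  let a : Fin m → ℕ := fun i => n * i.val
  let b : Fin n → ℕ := fun j => j.val
  have hwt : Function.Injective fun q : Fin m × Fin n => a q.1 + b q.2 := by
    rintro ⟨i, j⟩ ⟨i', j'⟩ h
    have hn : 0 < n := Nat.pos_of_ne_zero fun H => Nat.not_lt_zero j.1 (H ▸ j.2)
    simp only [a, b] at h
    have h1 : (n * i.1 + j.1) / n = i.1 := by
      rw [add_comm, Nat.add_mul_div_left _ _ hn, Nat.div_eq_of_lt j.2, zero_add]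
    have h1' : (n * i'.1 + j'.1) / n = i'.1 := by
      rw [add_comm, Nat.add_mul_div_left _ _ hn, Nat.div_eq_of_lt j'.2, zero_add]
    have h2 : (n * i.1 + j.1) % n = j.1 := by
      rw [add_comm, Nat.add_mul_mod_self_left, Nat.mod_eq_of_lt j.2]
    have h2' : (n * i'.1 + j'.1) % n = j'.1 := by
      rw [add_comm, Nat.add_mul_mod_self_left, Nat.mod_eq_of_lt j'.2]
    have hi : i = i' := Fin.ext (by rw [← h1, h, h1'])
    have hj : j = j' := Fin.ext (by rw [← h2, h, h2'])
    rw [hi, hj]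
  -- the leading positions of `W`
  let L : Finset (Fin m × Fin n) := Finset.univ.filter fun q =>
    ∃ w ∈ W, w q.1 q.2 ≠ 0 ∧ ∀ q' : Fin m × Fin n, a q'.1 + b q'.2 < a q.1 + b q.2 → w q'.1 q'.2 = 0
  have hL : ∀ w ∈ W, w ≠ 0 → ∃ q ∈ L, w q.1 q.2 ≠ 0 := by
    intro w hw hne
    obtain ⟨q, hq, hbelow⟩ := exists_lead (fun q : Fin m × Fin n => a q.1 + b q.2) w hne
    exact ⟨q, Finset.mem_filter.2 ⟨Finset.mem_univ _, w, hw, hq, hbelow⟩, hq⟩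
  have hfin : Module.finrank K W ≤ L.card := finrank_le_card_of_support W L hL
  have hwit : ∀ q : L, ∃ w ∈ W, w q.1.1 q.1.2 ≠ 0 ∧
      ∀ q' : Fin m × Fin n, a q'.1 + b q'.2 < a q.1.1 + b q.1.2 → w q'.1 q'.2 = 0 :=
    fun q => (Finset.mem_filter.1 q.2).2
  choose w hwW hlead hbelow using hwit
  -- `L` meets no `r` cells in pairwise distinct rows and columns
  have hnomatch : ¬ ∃ (ρ : Fin r ↪ Fin m) (γ : Fin r ↪ Fin n), ∀ x, (ρ x, γ x) ∈ L := by
    rintro ⟨ρ, γ, hργ⟩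
    have hMsupp : ∀ q : Fin m × Fin n, q ∉ Set.range (Subtype.val : L → Fin m × Fin n) →
        (fun i j => if ∃ z, ρ z = i ∧ γ z = j then (1 : K) else 0) q.1 q.2 = 0 := by
      intro q hq
      show (if ∃ z, ρ z = q.1 ∧ γ z = q.2 then (1 : K) else 0) = 0
      rw [if_neg]
      rintro ⟨z, hz1, hz2⟩
      exact hq ⟨⟨(ρ z, γ z), hργ z⟩, Prod.ext hz1 hz2⟩
    have hD := wsum_vanish_of_leads a b hwt W ε ρ γ (fun M hM => hvan M hM ρ γ)
      (Subtype.val : L → Fin m × Fin n) Subtype.val_injective w hwW hlead hbelow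
      (fun i j => if ∃ z, ρ z = i ∧ γ z = j then (1 : K) else 0) hMsupp
    simp only [indicator_submatrix_eq_one ρ γ] at hD
    rw [wsum_one] at hD
    exact hε hD
  have hC := card_le_of_no_matching hmn L hnomatch
  rw [hW] at hfin
  exact Nat.lt_of_succ_le (hfin.trans hC)

/-- **Chan–Ilten 2015, Proposition 2.6 — DISCHARGED** (`proposition26` is a theorem): the "if" halves are
`proposition26_if`; the "only if" halves are `lt_of_wsum_vanish` with `ε = sign` (minors, via
`Matrix.det_apply'`) and `ε = 1` (sub-permanents, `Matrix.permanent`), `K = K̄` being infinite.  The hypothesis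
`char K ≠ 2` of the permanental half is not needed for this direction. [cite: ChanIlten2015, Proposition 2.6] -/
theorem proposition26_holds : proposition26 := by
  intro K _ _ r m n k _ hrm hmn
  haveI : Infinite K := IsAlgClosed.instInfinite
  refine ⟨⟨fun h => ?_, fun hk => (proposition26_if hrm hk).1⟩,
    fun _ => ⟨fun h => ?_, fun hk => (proposition26_if hrm hk).2⟩⟩
  · obtain ⟨W, hW, hv⟩ := h
    refine lt_of_wsum_vanish hmn (fun σ => ((Equiv.Perm.sign σ : ℤˣ) : ℤ)) (by simp) W hW ?_
    intro M hM ρ γ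
    have h := hv M hM ρ γ
    rw [Matrix.det_apply'] at h
    simpa only [Matrix.submatrix_apply] using h
  · obtain ⟨W, hW, hv⟩ := h
    refine lt_of_wsum_vanish hmn (fun _ => 1) (by simp) W hW ?_
    intro M hM ρ γ
    have h := hv M hM ρ γ
    simp only [Matrix.permanent, Matrix.submatrix_apply] at h
    simpa only [Int.cast_one, one_mul] using h

end Assembly

end Literature.AlgebraicGeometry.DeterminantalHypersurfaces.ChanIlten
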